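import Literature.Probability.RandomPlanarGeometry.LoewnerBoundaryExtension
import Literature.Probability.RandomPlanarGeometry.SLERestrictionSlidHull
import Literature.Probability.RandomPlanarGeometry.EllipseHulls
import Literature.Probability.RandomPlanarGeometry.RestrictionPullback
import Literature.Probability.RandomPlanarGeometry.RestrictionHullsRiemannProofs
import Literature.Probability.RandomPlanarGeometry.LoewnerSemigroup
import Literature.Probability.RandomPlanarGeometry.HullSubordination
import Literature.Analysis.Complex.AnnulusCrossing
import Literature.Topology.PlaneTopology.HalfDiscCrosscut
import HarnessLib

/-!
# [LSW] Lemma 6.2 for chains generated by a simple curve: `g'_{A_T}(W_T) → 1` at exit times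

G. F. Lawler, O. Schramm, W. Werner, *Conformal restriction: the chordal case*, J. Amer. Math.
Soc. **16** (2003) 917–955, arXiv:math/0209343 (**[LSW]**), Lemma 6.2 (p. 23): "Let `A ∈ 𝒬₊`,
let `W : [0, ∞) → ℝ` be continuous, and let `g_t` be the corresponding solution of (2.5). Let
`K_t` be the associated growing hull, and suppose that `⋃_{t>0} K_t ∩ A = ∅`. Let
`T(r) := sup{t ≥ 0 : K_t ⊂ r𝕌}` and `A_t = g_t(A)`. Then `lim_{r → ∞} g'_{A_{T(r)}}(W_{T(r)}) = 1`."

The tree vendors this as the named fact `Loewner.restrictionDeriv_exitTime_gt`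
(`SLERestrictionLemmas`), for ALL continuous driving functions. This file PROVES it for the
chains that occur in the application to SLE_{8/3} ([LSW] Thm. 6.1): chains from the origin
(`W 0 = 0`, as everywhere in [LSW]) generated by a SIMPLE curve — the new, weaker named fact
`Loewner.restrictionDeriv_exitTime_gt_simple` and its proof `…_holds`.

**Proof** (the printed extremal-length argument, made quantitative by the length–area
inequalities of `Literature.Analysis.Complex.AnnulusCrossing`). Fix `r` large and an exit time
`t = T(r)`: the tip `z₀ = γ(t)` lies on `|z| = r` and `γ[0, t)` inside (`norm_apply_exitTime`,
`norm_lt_of_lt_exitTime`). Let `g = gₜ`, `f̄ = f̄ₜ` its inverse extended to `ℍ̄`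
(`LoewnerBoundaryExtension`), `p = g(a₀) - Wₜ > 0` for the leftmost real point `a₀` of `A`, and
`Ã = g(A') - Wₜ` for the connected set `A' = A ∪ [a₀, R₀]` ([LSW]: "`A' = A ∪ [a₀, a₁]` … `Ã` is
connected"); let `m` be the largest distance of a point of `Ã` from `p`.
1. *Topology.* `γ[0, t]` is a cross-cut of the half-disc `{|z| < r} ∩ ℍ` from `0` to `z₀`; its
   two sides `U₁` (right) and `U₂` (left) come from Newman's theorem (`HalfDiscCrosscut`).
2. *Boundary values.* A real `v ≠ Wₜ` between `g(-r)` and `g(r)` has `|f̄ v| < r` (boundary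
   dichotomy and TIP UNIQUENESS `eq_driving_of_bdryInv_eq`); `f` maps the points of `ℍ` near such
   a `v` into `U₁` if `v > Wₜ` and into `U₂` if `v < Wₜ` (`subset_side_of_mem_Ioo_right/left`:
   the side is locally constant in `v` and known next to `g(± r/2)`), while real `v ≤ g(-r)` have
   `|f̄ v| ≥ r`.
3. *Every semicircle about `Wₜ` of radius `s ∈ (0, p)` is mapped by `f̄` onto a curve reaching
   `|z| ≥ r`* (`exists_le_norm_bdryInv_circleMap`): otherwise its image would run inside
   `U₁ ⊔ U₂` from `U₁` (near `Wₜ + s`) to `U₂` (near `Wₜ - s`).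
4. *Length–area.* For `u ∈ (m/2, m)` the circle of radius `u` about `p` meets `Ã` (intermediate
   value theorem on the connected `A'`), at a point whose `f̄`-image lies in `A'`, `|·| ≤ R₀`;
   together with 3 (radius `p - u` about `Wₜ`) and the junction `p - u`, either family of
   semicircles crosses an annulus of logarithmic width `≍ log (r/R₀)`, so
   `AnnulusCrossing.mul_log_le_of_forall_crossing_or` gives `m/p → 0` as `r → ∞`.
5. *Comparison.* `A_t - Wₜ ⊆ Ã ⊆ D̄(p, m)`, and a `*`-hull inside `D̄(p, δp)` has
   `Φ'(0) > 1 - ε` for small `δ` (`exists_delta_lt_restrictionDeriv`: dilate a thin half-ellipse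
   hull of `EllipseHulls` and use monotonicity of `Φ'(0)`).
-/

noncomputable section

open Set Filter Topology Metric Complex
open UpperHalfPlane (upperHalfPlaneSet isOpen_upperHalfPlaneSet)
open scoped NNReal Pointwise Real

namespace Literature.Probability.RandomPlanarGeometry

/-! ### Small hulls far from the origin have `Φ'(0)` close to `1` -/

/-- **A hull of relative size `δ` about a positive real point has `Φ'(0) > 1 - ε`**: for every
`ε > 0` there is `δ > 0` such that every `*`-hull `B` contained in the closed disc of radius
`δ p` about a real point `p > 0` has `Φ'_B(0) > 1 - ε` (for any restriction data of `B`).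
Compare `B ⊆ p · E` with the dilate of a thin half-ellipse hull `E = B(1/2, 3/2; ρ)` around
`[1/2, 3/2]`, whose `Φ'_E(0) = ellDeriv (1/2) (3/2) ρ → 1` as `ρ → 1` (`EllipseHulls`), using
monotonicity (`HasRestrictionDeriv.le_of_subset`) and dilation invariance
(`HasRestrictionDeriv.smulHull`) of `Φ'(0)`. [folklore] -/
theorem exists_delta_lt_restrictionDeriv {ε : ℝ} (hε : 0 < ε) :
    ∃ δ > 0, ∀ {p : ℝ}, 0 < p → ∀ {B : Set ℂ}, IsStarHull B → B ⊆ closedBall (p : ℂ) (δ * p) →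
      ∀ {Ψ : ConformalEquiv (upperHalfPlaneSet \ B) upperHalfPlaneSet} {e : ℝ},
        IsRestrictionMap B Ψ → HasRestrictionDeriv B Ψ e → 1 - ε < e := by
  -- the comparison ellipse `E = B(1/2, 3/2; ρ)` with `ρ` close to `1`
  have hab : (1 / 2 : ℝ) < 3 / 2 := by norm_num
  have ha : (0 : ℝ) < 1 / 2 := by norm_num
  obtain ⟨θ, hθ, hθd⟩ := Metric.tendsto_nhds_nhds.1 (tendsto_ellDeriv (1 / 2 : ℝ) (3 / 2)) ε hε
  set ρ : ℝ := max (1 / 2) (1 - θ / 2) with hρdef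
  have hρ0 : 0 < ρ := lt_of_lt_of_le (by norm_num) (le_max_left _ _)
  have hρ1 : ρ < 1 := max_lt (by norm_num) (by linarith)
  have hρhalf : 1 / 2 ≤ ρ := le_max_left _ _
  have hdist : dist ρ 1 < θ := by
    rw [Real.dist_eq, abs_of_nonpos (by linarith), neg_sub]
    have : 1 - θ / 2 ≤ ρ := le_max_right _ _
    linarith
  have hderiv : 1 - ε < ellDeriv (1 / 2) (3 / 2) ρ := by
    have h := hθd hdist
    rw [ellDeriv_one hab ha, Real.dist_eq, abs_lt] at h
    linarith [h.1]
  have hH : ellH (1 / 2 : ℝ) (3 / 2) = 1 / 4 := by norm_num [ellH]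
  have hC : ellC (1 / 2 : ℝ) (3 / 2) = 1 := by norm_num [ellC]
  have hlevel : jLevel ρ ≤ jLevel (1 / 2) := jLevel_le_jLevel (by norm_num) hρhalf hρ1.le
  have hlevel_half : jLevel (1 / 2 : ℝ) = 5 / 2 := by norm_num [jLevel]
  have hcond : ellH (1 / 2 : ℝ) (3 / 2) * jLevel ρ < ellC (1 / 2) (3 / 2) := by
    rw [hH, hC]
    linarith
  have hlevel2 : 2 < jLevel ρ := by
    have := jLevel_lt_jLevel hρ0 hρ1 le_rfl
    rwa [jLevel_one] at this
  set δ : ℝ := ellH (1 / 2 : ℝ) (3 / 2) * (jLevel ρ - 2) / 2 with hδdef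
  have hδ : 0 < δ := by
    rw [hδdef, hH]
    linarith
  refine ⟨δ, hδ, fun {p} hp {B} hB hBsub {Ψ} {e} hΨ he ↦ ?_⟩
  set E : Set ℂ := ellHull (1 / 2) (3 / 2) ρ with hEdef
  have hE : IsStarHull E := (isPlusHull_ellHull hab hρ0 hρ1 hcond).1
  -- `B ⊆ p • E`
  have hsub : B ⊆ p • E := by
    intro z hz
    have hz' : p⁻¹ • z ∈ E := by
      have him : 0 ≤ z.im := by
        have := hB.isBoundedHull.subset_closure hz
        rw [show closure upperHalfPlaneSet = {z : ℂ | 0 ≤ z.im} from closure_setOf_lt_im 0] at this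
        exact this
      refine ⟨?_, ?_⟩
      · refine mem_ellRegion_of_infDist_lt hab (δ := 2 * δ) (by rw [hδdef]; linarith) ?_
        have h1 : infDist (p⁻¹ • z) (realSeg (1 / 2 : ℝ) (3 / 2)) ≤ dist (p⁻¹ • z) 1 :=
          infDist_le_dist_of_mem (by
            have : ((1 : ℝ) : ℂ) ∈ realSeg (1 / 2 : ℝ) (3 / 2) :=
              ofReal_mem_realSeg.2 (by rw [uIcc_of_le hab.le]; constructor <;> norm_num)
            simpa using this)
        have h2 : dist (p⁻¹ • z) 1 ≤ δ := by
          have hzd : dist z p ≤ δ * p := mem_closedBall.1 (hBsub hz)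
          rw [dist_eq_norm] at hzd ⊢
          have hp' : (p : ℂ) ≠ 0 := by exact_mod_cast hp.ne'
          have : p⁻¹ • z - 1 = (p⁻¹ : ℂ) * (z - p) := by
            rw [Complex.real_smul, mul_sub, ofReal_inv, inv_mul_cancel₀ hp']
          rw [this, norm_mul, norm_inv, Complex.norm_real, Real.norm_eq_abs, abs_of_pos hp,
            inv_mul_le_iff₀ hp]
          linarith
        linarith
      · show 0 ≤ (p⁻¹ • z).im
        rw [Complex.real_smul, mul_im, ofReal_re, ofReal_im, zero_mul, add_zero]
        exact mul_nonneg (inv_nonneg.2 hp.le) him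
    have : z = p • (p⁻¹ • z) := by rw [smul_smul, mul_inv_cancel₀ hp.ne', one_smul]
    rw [this]
    exact Set.smul_mem_smul_set hz'
  -- compare `Φ'(0)`
  have hd := HasRestrictionDeriv.smulHull hp (hasRestrictionDeriv_ellConf hab hρ0 hρ1 hcond)
  have hle := HasRestrictionDeriv.le_of_subset (hE.smul hp) hB hsub
    (IsRestrictionMap.smulHull (isRestrictionMap_ellConf hab hρ0 hρ1 hcond) hp) hΨ hd he
  exact hderiv.trans_le hle

/-! ### Two elementary lemmas on intervals -/

/-- A continuous map of an open interval into the disjoint union of two open sets cannot take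
values in both. [folklore] -/
theorem not_mem_and_mem_of_continuousOn {φ : ℝ → ℂ} {a b : ℝ} {U V : Set ℂ}
    (hφ : ContinuousOn φ (Ioo a b)) (hU : IsOpen U) (hV : IsOpen V) (hUV : Disjoint U V)
    (hsub : ∀ τ ∈ Ioo a b, φ τ ∈ U ∪ V) {τ₁ τ₂ : ℝ} (h₁ : τ₁ ∈ Ioo a b) (h₂ : τ₂ ∈ Ioo a b)
    (hU₁ : φ τ₁ ∈ U) (hV₂ : φ τ₂ ∈ V) : False := by
  have hpre : IsPreconnected (φ '' Ioo a b) := isPreconnected_Ioo.image φ hφ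
  have himg : φ '' Ioo a b ⊆ U ∪ V := by
    rintro _ ⟨τ, hτ, rfl⟩
    exact hsub τ hτ
  rcases hpre.subset_or_subset hU hV hUV himg with h | h
  · exact Set.disjoint_left.1 hUV (h ⟨τ₂, h₂, rfl⟩) hV₂
  · exact Set.disjoint_left.1 hUV (hU₁) (h ⟨τ₁, h₁, rfl⟩)

/-- If a function continuous on `[a, b]` (`a < b`) takes a value in an open set at some point
of `[a, b]`, it does so at a point of the open interval `(a, b)`. [folklore] -/
theorem exists_mem_Ioo_mem_of_continuousOn {ψ : ℝ → ℂ} {a b : ℝ} (hab : a < b)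
    (hψ : ContinuousOn ψ (Icc a b)) {θ₀ : ℝ} (hθ₀ : θ₀ ∈ Icc a b) {O : Set ℂ} (hO : IsOpen O)
    (hmem : ψ θ₀ ∈ O) : ∃ θ ∈ Ioo a b, ψ θ ∈ O := by
  have hev : ∀ᶠ θ in 𝓝[Icc a b] θ₀, ψ θ ∈ O := hψ θ₀ hθ₀ (hO.mem_nhds hmem)
  -- the open interval accumulates at every point of `[a, b]`
  have hcl : θ₀ ∈ closure (Ioo a b) := by
    rw [closure_Ioo hab.ne]
    exact hθ₀
  haveI : (𝓝[Ioo a b] θ₀).NeBot := mem_closure_iff_nhdsWithin_neBot.1 hcl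
  have hfreq : ∃ᶠ θ in 𝓝[Icc a b] θ₀, θ ∈ Ioo a b :=
    ((eventually_mem_nhdsWithin : ∀ᶠ θ in 𝓝[Ioo a b] θ₀, θ ∈ Ioo a b).frequently).filter_mono
      (nhdsWithin_mono θ₀ Ioo_subset_Icc_self)
  obtain ⟨θ, hθ, hθO⟩ := (hfreq.and_eventually hev).exists
  exact ⟨θ, hθ, hθO⟩

/-! ### The hull with its base interval: real points and connectedness -/

section HullBase

variable {A : Set ℂ}

/-- A nonempty bounded hull has a real point (a hull has no floating pieces:
`IsBoundedHull.isConnected_union_im_nonpos`). [folklore] -/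
theorem IsBoundedHull.exists_ofReal_mem (hA : IsBoundedHull A) (hne : A.Nonempty) :
    ∃ x : ℝ, (x : ℂ) ∈ A := by
  by_contra h
  push Not at h
  -- then `A ⊆ ℍₒ`
  have hAH : ∀ z ∈ A, 0 < z.im := fun z hz ↦ by
    rcases (hA.im_nonneg hz).eq_or_lt with h0 | hpos
    · have hz' : z = ((z.re : ℝ) : ℂ) := by
        rw [← Complex.re_add_im z, ← h0]
        simp
      rw [hz'] at hz
      exact absurd hz (h z.re)
    · exact hpos
  have hconn := (hA.isConnected_union_im_nonpos).isPreconnected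
  rw [isPreconnected_iff_subset_of_disjoint_closed] at hconn
  have hL : IsClosed {z : ℂ | z.im ≤ 0} := isClosed_le continuous_im continuous_const
  have hdisj : (A ∪ {z : ℂ | z.im ≤ 0}) ∩ (A ∩ {z : ℂ | z.im ≤ 0}) = ∅ := by
    rw [Set.eq_empty_iff_forall_notMem]
    rintro z ⟨-, hzA, hzL⟩
    exact absurd (hAH z hzA) (not_lt.2 hzL)
  rcases hconn A {z : ℂ | z.im ≤ 0} hA.isClosed hL Subset.rfl hdisj with hsub | hsub
  · have hmem : (-Complex.I : ℂ) ∈ A := hsub (Or.inr (by simp))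
    have := hAH _ hmem
    norm_num at this
  · obtain ⟨z, hz⟩ := hne
    have hzL : z.im ≤ 0 := hsub (Or.inl hz)
    exact absurd (hAH z hz) (not_lt.2 hzL)

/-- The real points of a nonempty `+`-hull have a positive minimum `a₀ ∈ A`. [folklore] -/
theorem IsPlusHull.exists_min_ofReal (hA : IsPlusHull A) (hne : A.Nonempty) :
    ∃ a₀ : ℝ, 0 < a₀ ∧ (a₀ : ℂ) ∈ A ∧ ∀ x : ℝ, (x : ℂ) ∈ A → a₀ ≤ x := by
  set S : Set ℝ := {x : ℝ | (x : ℂ) ∈ A} with hS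
  have hSc : IsClosed S := hA.1.isBoundedHull.isClosed.preimage Complex.continuous_ofReal
  have hSb : Bornology.IsBounded S := by
    obtain ⟨R, hR⟩ := hA.1.isBoundedHull.1.subset_closedBall 0
    refine (Metric.isBounded_Icc (-R) R).subset fun x hx ↦ ?_
    have h := hR hx
    rw [mem_closedBall, dist_zero_right, Complex.norm_real, Real.norm_eq_abs, abs_le] at h
    exact h
  have hSne : S.Nonempty := hA.1.isBoundedHull.exists_ofReal_mem hne
  have hcpt : IsCompact S := Metric.isCompact_of_isClosed_isBounded hSc hSb
  exact ⟨sInf S, hA.2 _ (hcpt.sInf_mem hSne), hcpt.sInf_mem hSne,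
    fun x hx ↦ csInf_le hcpt.bddBelow hx⟩

/-- **The hull together with a base interval is connected**: if `A` is a bounded hull all of
whose real points lie in `[a₀, R]` (`a₀ ≤ R`), then `A ∪ [a₀, R]` is connected. (A separation
would split off a compact piece of `A` inside `ℍₒ`, separating `A ∪ {im ≤ 0}`, which is
connected by `IsBoundedHull.isConnected_union_im_nonpos`.) In [LSW] Lemma 6.2: "`A' = A ∪ [a₀, a₁]`
… Because `Ã` is connected". [cite: LawlerSchrammWerner2003Restriction, proof of Lemma 6.2] -/
theorem IsBoundedHull.isConnected_union_ofReal_image (hA : IsBoundedHull A) {a₀ R : ℝ} (haR : a₀ ≤ R)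
    (hreal : ∀ x : ℝ, (x : ℂ) ∈ A → x ∈ Icc a₀ R) :
    IsConnected (A ∪ Complex.ofReal '' Icc a₀ R) := by
  set Iv : Set ℂ := Complex.ofReal '' Icc a₀ R with hIvdef
  set T : Set ℂ := A ∪ Iv with hTdef
  set L : Set ℂ := {z : ℂ | z.im ≤ 0} with hLdef
  have hIc : IsConnected Iv := (isConnected_Icc haR).image _ Complex.continuous_ofReal.continuousOn
  have hIclosed : IsClosed Iv := (isCompact_Icc.image Complex.continuous_ofReal).isClosed
  have hTclosed : IsClosed T := hA.isClosed.union hIclosed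
  have hIL : Iv ⊆ L := by
    rintro _ ⟨x, -, rfl⟩
    show (x : ℂ).im ≤ 0
    simp
  have hLc : IsClosed L := isClosed_le continuous_im continuous_const
  -- real points of `T` lie in `Iv`
  have hTreal : ∀ z ∈ T, z.im ≤ 0 → z ∈ Iv := by
    rintro z hzT hzim
    rcases hzT with hzA | hzI
    · have h0 : z.im = 0 := le_antisymm hzim (hA.im_nonneg hzA)
      have hz' : z = ((z.re : ℝ) : ℂ) := by
        rw [← Complex.re_add_im z, h0]
        simp
      rw [hz'] at hzA ⊢
      exact ⟨z.re, hreal _ hzA, rfl⟩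
    · exact hzI
  refine ⟨⟨(a₀ : ℂ), Or.inr ⟨a₀, left_mem_Icc.2 haR, rfl⟩⟩, ?_⟩
  rw [isPreconnected_iff_subset_of_disjoint_closed]
  -- if `Iv ⊆ F` then `T ⊆ F`
  have key : ∀ F G : Set ℂ, IsClosed F → IsClosed G → T ⊆ F ∪ G → T ∩ (F ∩ G) = ∅ →
      Iv ⊆ F → T ⊆ F := by
    intro F G hF hG hcover hdisj hIF
    rw [Set.eq_empty_iff_forall_notMem] at hdisj
    -- the piece `K = T ∩ G` is closed and inside `ℍₒ`
    set K : Set ℂ := T ∩ G with hKdef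
    have hKclosed : IsClosed K := hTclosed.inter hG
    have hKH : ∀ z ∈ K, 0 < z.im := by
      rintro z ⟨hzT, hzG⟩
      by_contra hle
      rw [not_lt] at hle
      exact hdisj z ⟨hzT, hIF (hTreal z hzT hle), hzG⟩
    -- `A ∪ L = K ⊔ ((T ∩ F) ∪ L)`: closed pieces; connectedness forces `K = ∅`
    have hconn := (hA.isConnected_union_im_nonpos).isPreconnected
    rw [isPreconnected_iff_subset_of_disjoint_closed] at hconn
    have hcover' : A ∪ L ⊆ K ∪ ((T ∩ F) ∪ L) := by
      rintro z (hzA | hzL)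
      · rcases hcover (Or.inl hzA) with hzF | hzG
        · exact Or.inr (Or.inl ⟨Or.inl hzA, hzF⟩)
        · exact Or.inl ⟨Or.inl hzA, hzG⟩
      · exact Or.inr (Or.inr hzL)
    have hdisj' : (A ∪ L) ∩ (K ∩ ((T ∩ F) ∪ L)) = ∅ := by
      rw [Set.eq_empty_iff_forall_notMem]
      rintro z ⟨-, hzK, hz2⟩
      rcases hz2 with ⟨hzT, hzF⟩ | hzL
      · exact hdisj z ⟨hzT, hzF, hzK.2⟩
      · exact absurd (hKH z hzK) (not_lt.2 hzL)
    rcases hconn K ((T ∩ F) ∪ L) hKclosed ((hTclosed.inter hF).union hLc) hcover' hdisj' with h | h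
    · -- `A ∪ L ⊆ K` is absurd: `-i ∈ L` is not in `ℍₒ`
      have hmem : (-Complex.I : ℂ) ∈ K := h (Or.inr (by show (-Complex.I : ℂ).im ≤ 0; simp))
      have := hKH _ hmem
      norm_num at this
    · intro z hzT
      rcases hcover hzT with hzF | hzG
      · exact hzF
      · exfalso
        have hzAL : z ∈ A ∪ L := hzT.elim Or.inl fun hzI ↦ Or.inr (hIL hzI)
        rcases h hzAL with ⟨-, hzF⟩ | hzL
        · exact hdisj z ⟨hzT, hzF, hzG⟩
        · exact absurd (hKH z ⟨hzT, hzG⟩) (not_lt.2 hzL)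
  intro F G hF hG hcover hdisj
  have hIside : Iv ⊆ F ∨ Iv ⊆ G :=
    (isPreconnected_iff_subset_of_disjoint_closed.1 hIc.isPreconnected) F G hF hG
      (subset_union_right.trans hcover) (by
        rw [Set.eq_empty_iff_forall_notMem] at hdisj ⊢
        exact fun z hz ↦ hdisj z ⟨Or.inr hz.1, hz.2⟩)
  rcases hIside with hIF | hIG
  · exact Or.inl (key F G hF hG hcover hdisj hIF)
  · exact Or.inr (key G F hG hF (by rwa [union_comm]) (by rwa [inter_comm F G] at hdisj) hIG)

end HullBase

/-! ### Exit times of a chain generated by a simple curve -/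

namespace Loewner

section ExitTime

variable {W : ℝ≥0 → ℝ} {γ : ℝ≥0 → ℂ} {r : ℝ} {t : ℝ≥0}
variable (hW : Continuous W) (hW0 : W 0 = 0) (hγ : IsGeneratedByCurve W γ) (hs : IsSimpleTrace γ)
include hW hW0 hγ hs

omit hW hW0 in
/-- Before an exit time of the disc `r𝕌` the curve is inside the disc. [folklore] -/
theorem norm_lt_of_lt_exitTime (hex : IsExitTime W r t) {s : ℝ≥0} (hst : s < t) : ‖γ s‖ < r := by
  have h := hex.1 s hst (image_subset_closedHull_of_isSimpleTrace hγ hs s ⟨s, ⟨bot_le, le_rfl⟩, rfl⟩)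
  rwa [mem_ball, dist_zero_right] at h

/-- An exit time of a disc of positive radius is positive (the curve starts at `0`). [folklore] -/
theorem exitTime_pos (hr : 0 < r) (hex : IsExitTime W r t) : 0 < t := by
  rcases (show (0 : ℝ≥0) ≤ t from bot_le).eq_or_lt with h | h
  · exfalso
    -- `γ` stays in the disc for a short while
    have h0 : ‖γ 0‖ < r := by rw [hγ.apply_zero, hW0, Complex.ofReal_zero, norm_zero]; exact hr
    have hcont : ContinuousAt (fun s ↦ ‖γ s‖) 0 := (hγ.continuous.norm).continuousAt
    obtain ⟨δ, hδ, hball⟩ := Metric.eventually_nhds_iff.1 (hcont.eventually (gt_mem_nhds h0))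
    set s : ℝ≥0 := ⟨δ / 2, by positivity⟩ with hsdef
    have hscoe : (s : ℝ) = δ / 2 := rfl
    have hspos : 0 < s := by rw [← NNReal.coe_pos, hscoe]; positivity
    refine hex.2 s (h ▸ hspos) fun z hz ↦ ?_
    obtain ⟨s', hs', rfl⟩ := closedHull_subset_image_of_isSimpleTrace hW hW0 hγ hs s hz
    rw [mem_ball, dist_zero_right]
    refine hball ?_
    rw [NNReal.dist_eq, NNReal.coe_zero, sub_zero, abs_of_nonneg s'.coe_nonneg]
    have : (s' : ℝ) ≤ s := by exact_mod_cast hs'.2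
    linarith
  · exact h

/-- **At an exit time the tip lies on the circle**: `|γ(T(r))| = r`. [cite: LawlerSchrammWerner2003Restriction, proof of Lemma 6.2 (z₀ ∈ K_T, |z₀| = r)] -/
theorem norm_apply_exitTime (hr : 0 < r) (hex : IsExitTime W r t) : ‖γ t‖ = r := by
  have ht := exitTime_pos hW hW0 hγ hs hr hex
  apply le_antisymm
  · -- from the left: `‖γ s‖ < r` for `s < t`
    haveI : (𝓝[<] t).NeBot := nhdsLT_neBot_of_exists_lt ⟨0, ht⟩
    have hlim : Tendsto (fun s ↦ ‖γ s‖) (𝓝[<] t) (𝓝 ‖γ t‖) :=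
      ((hγ.continuous.norm).tendsto t).mono_left nhdsWithin_le_nhds
    refine le_of_tendsto hlim ?_
    filter_upwards [self_mem_nhdsWithin] with s hs'
    exact (norm_lt_of_lt_exitTime hγ hs hex hs').le
  · -- from the right: after `t` the closed hull pokes out of the disc
    set sq : ℕ → ℝ≥0 := fun n ↦ t + ⟨1 / ((n : ℝ) + 1), by positivity⟩ with hsq
    have hpoke : ∀ n, ∃ s' : ℝ≥0, t ≤ s' ∧ s' ≤ sq n ∧ r ≤ ‖γ s'‖ := by
      intro n
      have hlt : t < sq n := by
        rw [hsq]; exact lt_add_of_pos_right _ (by change (0 : ℝ) < 1 / ((n : ℝ) + 1); positivity)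
      have h := hex.2 (sq n) hlt
      rw [not_subset] at h
      obtain ⟨z, hz, hzr⟩ := h
      obtain ⟨s', hs', rfl⟩ := closedHull_subset_image_of_isSimpleTrace hW hW0 hγ hs (sq n) hz
      rw [mem_ball, dist_zero_right, not_lt] at hzr
      refine ⟨s', ?_, hs'.2, hzr⟩
      by_contra hlt'
      exact (norm_lt_of_lt_exitTime hγ hs hex (not_le.1 hlt')).not_ge hzr
    choose s' hts' hs'q hrs' using hpoke
    have hlim : Tendsto s' atTop (𝓝 t) := by
      have h1 : Tendsto sq atTop (𝓝 t) := by
        rw [← NNReal.tendsto_coe]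
        have h : Tendsto (fun n : ℕ ↦ (t : ℝ) + 1 / ((n : ℝ) + 1)) atTop (𝓝 ((t : ℝ) + 0)) :=
          tendsto_const_nhds.add tendsto_one_div_add_atTop_nhds_zero_nat
        rw [add_zero] at h
        have hcoe : (fun n : ℕ ↦ (sq n : ℝ)) = fun n : ℕ ↦ (t : ℝ) + 1 / ((n : ℝ) + 1) := by
          funext n
          simp only [hsq, NNReal.coe_add]
          rfl
        rw [hcoe]
        exact h
      exact tendsto_of_tendsto_of_tendsto_of_le_of_le tendsto_const_nhds h1 hts' hs'q
    exact ge_of_tendsto ((hγ.continuous.norm.tendsto t).comp hlim) (Eventually.of_forall hrs')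

/-- The tip at an exit time lies in the open upper half-plane. [folklore] -/
theorem apply_exitTime_im_pos (hr : 0 < r) (hex : IsExitTime W r t) : 0 < (γ t).im :=
  hs.2 t (exitTime_pos hW hW0 hγ hs hr hex)

/-! ### Boundary values on the real segments next to the driving point -/

/-- For real `v ∈ (Wₜ, gₜ r)`: `|f̄ₜ v| < r` (either `v = gₜ x` with `0 < x < r` and `f̄ₜ v = x`,
or `f̄ₜ v = γ s` with `s < t` — not the tip, by `eq_driving_of_bdryInv_eq`). [folklore] -/
theorem norm_bdryInv_lt_of_mem_Ioo_right (hr : 0 < r) (hex : IsExitTime W r t) {v : ℝ}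
    (hv : v ∈ Ioo (W t) (map W t r).re) : ‖bdryInv W t v‖ < r := by
  have ht := exitTime_pos hW hW0 hγ hs hr hex
  rcases bdryInv_ofReal_dichotomy hW hW0 hγ hs t v with ⟨s', hs', heq⟩ | ⟨x, hx, hmap, heq⟩
  · rw [← heq]
    have hs't : s' ≠ t := fun h ↦ by
      rw [h] at heq
      have := hγ.eq_driving_of_bdryInv_eq hW hs ht heq.symm
      exact hv.1.ne' this
    exact norm_lt_of_lt_exitTime hγ hs hex (lt_of_le_of_ne hs'.2 hs't)
  · rw [heq, Complex.norm_real, Real.norm_eq_abs]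
    have hre : (map W t x).re = v := by rw [hmap, ofReal_re]
    have hxpos : 0 < x := by
      by_contra hle
      have hxneg : x < 0 := lt_of_le_of_ne (not_lt.1 hle) hx
      have := map_ofReal_re_lt_driving_of_isSimpleTrace hW hW0 hγ hs hxneg t
      rw [hre] at this
      exact absurd this (not_lt.2 hv.1.le)
    have hxr : x < r := by
      by_contra hle
      rw [not_lt] at hle
      have h : (map W t r).re ≤ (map W t x).re :=
        ((map_ofReal_re_strictMonoOn_pos_of_isSimpleTrace hW hW0 hγ hs t).le_iff_le hr hxpos).2 hle
      rw [hre] at h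
      exact absurd hv.2 (not_lt.2 h)
    rw [abs_of_pos hxpos]
    exact hxr

/-- For real `v ∈ (gₜ(-r), Wₜ)`: `|f̄ₜ v| < r`. [folklore] -/
theorem norm_bdryInv_lt_of_mem_Ioo_left (hr : 0 < r) (hex : IsExitTime W r t) {v : ℝ}
    (hv : v ∈ Ioo (map W t ((-r : ℝ) : ℂ)).re (W t)) : ‖bdryInv W t v‖ < r := by
  have ht := exitTime_pos hW hW0 hγ hs hr hex
  rcases bdryInv_ofReal_dichotomy hW hW0 hγ hs t v with ⟨s', hs', heq⟩ | ⟨x, hx, hmap, heq⟩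
  · rw [← heq]
    have hs't : s' ≠ t := fun h ↦ by
      rw [h] at heq
      have := hγ.eq_driving_of_bdryInv_eq hW hs ht heq.symm
      exact hv.2.ne this
    exact norm_lt_of_lt_exitTime hγ hs hex (lt_of_le_of_ne hs'.2 hs't)
  · rw [heq, Complex.norm_real, Real.norm_eq_abs]
    have hre : (map W t x).re = v := by rw [hmap, ofReal_re]
    have hxneg : x < 0 := by
      by_contra hle
      have hxpos : 0 < x := lt_of_le_of_ne (not_lt.1 hle) (Ne.symm hx)
      have := driving_lt_map_ofReal_re_of_isSimpleTrace hW hW0 hγ hs hxpos t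
      rw [hre] at this
      exact absurd this (not_lt.2 hv.2.le)
    have hxr : -r < x := by
      by_contra hle
      rw [not_lt] at hle
      have h : (map W t x).re ≤ (map W t ((-r : ℝ) : ℂ)).re :=
        ((map_ofReal_re_strictMonoOn_neg_of_isSimpleTrace hW hW0 hγ hs t).le_iff_le hxneg
          (show (-r : ℝ) ∈ Iio 0 by simp [hr])).2 hle
      rw [hre] at h
      exact absurd hv.1 (not_lt.2 h)
    rw [abs_of_neg hxneg]
    linarith

/-- Far to the left the boundary values are large: for real `v ≤ gₜ(-r)`, `|f̄ₜ v| ≥ r`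
(`v = gₜ x` for some real `x ≤ -r`, by the intermediate value theorem for the real, increasing,
asymptotically identical `gₜ` on `(-∞, 0)`). [folklore] -/
theorem le_norm_bdryInv_of_le_left (hr : 0 < r) {v : ℝ} (hv : v ≤ (map W t ((-r : ℝ) : ℂ)).re) :
    r ≤ ‖bdryInv W t v‖ := by
  -- far field: `|gₜ x - x| ≤ C` for `|x|` large
  obtain ⟨M, -, hM⟩ := exists_forall_norm_driving_sub_le hW t 0
  set δ : ℝ := 2 * Real.sqrt t + 1 with hδ
  have hδpos : 0 < δ := by positivity
  have hδt : 4 * (t : ℝ) ≤ δ ^ 2 := by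
    have h1 : Real.sqrt t ^ 2 = t := Real.sq_sqrt t.coe_nonneg
    nlinarith [Real.sqrt_nonneg (t : ℝ)]
  set C : ℝ := 2 / δ * t with hC
  have hC0 : 0 ≤ C := by positivity
  -- a far point `x₁ ≤ -r` with `gₜ x₁ ≤ v`
  set x₁ : ℝ := min (-r) (min (-(M + 2 * δ)) (v - C - 1)) with hx₁
  have hx₁r : x₁ ≤ -r := min_le_left _ _
  have hx₁M : x₁ ≤ -(M + 2 * δ) := (min_le_right _ _).trans (min_le_left _ _)
  have hx₁v : x₁ ≤ v - C - 1 := (min_le_right _ _).trans (min_le_right _ _)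
  have hx₁neg : x₁ < 0 := by linarith
  have hfar : M + 2 * δ ≤ ‖((x₁ : ℝ) : ℂ) - 0‖ := by
    rw [sub_zero, Complex.norm_real, Real.norm_eq_abs, abs_of_neg hx₁neg]
    linarith
  have hmove : ‖map W t x₁ - x₁‖ ≤ C := ((lt_swallowingTime_of_far hW hM hδpos hδt hfar).2 t le_rfl).2
  have hgx₁ : (map W t x₁).re ≤ v := by
    have h1 : (map W t x₁).re - x₁ ≤ C := by
      have := abs_re_le_norm (map W t x₁ - x₁)
      rw [sub_re, ofReal_re] at this
      exact (le_abs_self _).trans (this.trans hmove)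
    linarith
  -- intermediate value theorem on `[x₁, -r]`
  have hcont : ContinuousOn (fun x : ℝ ↦ (map W t x).re) (Icc x₁ (-r)) := by
    intro x hx
    have hx0 : x ≠ 0 := by
      have : x ≤ -r := hx.2
      intro h; rw [h] at this; linarith
    exact ((continuous_re.continuousAt.comp (continuousAt_map_ofReal_of_isSimpleTrace hW hW0 hγ hs hx0 t)).comp
      Complex.continuous_ofReal.continuousAt).continuousWithinAt
  obtain ⟨x, hx, hxv⟩ := intermediate_value_Icc hx₁r hcont ⟨hgx₁, hv⟩
  have hx0 : x ≠ 0 := by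
    have : x ≤ -r := hx.2
    intro h; rw [h] at this; linarith
  have hmapx : map W t x = (v : ℂ) := by
    rw [map_ofReal_eq_of_isSimpleTrace hW hW0 hγ hs hx0 t]
    exact congrArg _ hxv
  rw [← hmapx, bdryInv_map_ofReal hW hW0 hγ hs hx0 t, Complex.norm_real, Real.norm_eq_abs,
    abs_of_neg (by linarith [hx.2] : x < 0)]
  linarith [hx.2]

/-! ### The two sides of `γ[0, t]` in the half-disc, and the side of `fₜ` near the real axis -/

omit hW hW0 hγ hs in
/-- The curve `γ[0, t]` (`t > 0`), reparametrised by `[0, 1]`. [folklore] -/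
theorem image_reparam_eq (ht : 0 < t) :
    (fun x : ℝ ↦ γ ((x * t).toNNReal)) '' Icc 0 1 = γ '' Icc 0 t := by
  have ht' : (0 : ℝ) < t := ht
  apply Subset.antisymm
  · rintro _ ⟨x, hx, rfl⟩
    refine ⟨(x * t).toNNReal, ⟨bot_le, ?_⟩, rfl⟩
    rw [← NNReal.coe_le_coe, Real.coe_toNNReal _ (by nlinarith [hx.1])]
    nlinarith [hx.2]
  · rintro _ ⟨s', hs', rfl⟩
    refine ⟨s' / t, ⟨by positivity, ?_⟩, ?_⟩
    · rw [div_le_one ht']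
      exact_mod_cast hs'.2
    · show γ (((s' : ℝ) / t * t).toNNReal) = γ s'
      rw [div_mul_cancel₀ _ ht'.ne', Real.toNNReal_coe]

/-- **The two sides at an exit time**: the open sets `U₁` (right) and `U₂` (left) of
`HalfDiscCrosscut.exists_sides_of_arc` for the cross-cut `γ[0, t]` of the half-disc of radius
`r`, `t = T(r)`. [cite: Newman1939, Ch. V §11, Thms. 11·7 and 11·8] -/
theorem exists_sides_exitTime (hr : 0 < r) (hex : IsExitTime W r t) :
    ∃ U₁ U₂ : Set ℂ, IsOpen U₁ ∧ IsOpen U₂ ∧ Disjoint U₁ U₂ ∧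
      U₁ ∪ U₂ = (ball 0 r ∩ upperHalfPlaneSet) \ γ '' Icc 0 t ∧
      frontier U₁ ⊆ γ '' Icc 0 t ∪ {z : ℂ | ‖z‖ = r ∨ (z.im = 0 ∧ 0 ≤ z.re)} ∧
      frontier U₂ ⊆ γ '' Icc 0 t ∪ {z : ℂ | ‖z‖ = r ∨ (z.im = 0 ∧ z.re ≤ 0)} := by
  have ht := exitTime_pos hW hW0 hγ hs hr hex
  have ht' : (0 : ℝ) < t := ht
  set η : ℝ → ℂ := fun x ↦ γ ((x * t).toNNReal) with hη
  have hηc : ContinuousOn η (Icc 0 1) :=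
    (hγ.continuous.comp (continuous_real_toNNReal.comp (continuous_id.mul continuous_const))).continuousOn
  have hηi : InjOn η (Icc 0 1) := by
    intro x hx y hy hxy
    have h := hs.1 hxy
    have h' := congrArg (fun u : ℝ≥0 ↦ (u : ℝ)) h
    simp only [Real.coe_toNNReal _ (by nlinarith [hx.1] : 0 ≤ x * t),
      Real.coe_toNNReal _ (by nlinarith [hy.1] : 0 ≤ y * t)] at h'
    exact mul_right_cancel₀ ht'.ne' h'
  have hη0 : η 0 = 0 := by simp [hη, hγ.apply_zero, hW0]
  have hη1 : η 1 = γ t := by simp [hη]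
  have hin : ∀ x ∈ Ioo (0 : ℝ) 1, ‖η x‖ < r ∧ 0 < (η x).im := by
    intro x hx
    have hxt : (x * t).toNNReal < t := by
      rw [← NNReal.coe_lt_coe, Real.coe_toNNReal _ (by nlinarith [hx.1])]
      nlinarith [hx.2]
    have hxt0 : 0 < (x * t).toNNReal := by
      rw [← NNReal.coe_lt_coe, Real.coe_toNNReal _ (by nlinarith [hx.1]), NNReal.coe_zero]
      nlinarith [hx.1]
    exact ⟨norm_lt_of_lt_exitTime hγ hs hex hxt, hs.2 _ hxt0⟩
  obtain ⟨U₁, U₂, h1, h2, h3, h4, h5, h6⟩ :=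
    Literature.Topology.PlaneTopology.exists_sides_of_arc hr hηc hηi hη0 hη1
      (norm_apply_exitTime hW hW0 hγ hs hr hex) (apply_exitTime_im_pos hW hW0 hγ hs hr hex) hin
  rw [image_reparam_eq ht] at h4 h5 h6
  exact ⟨U₁, U₂, h1, h2, h3, h4, h5, h6⟩

omit hW hW0 hs in
/-- Points of `Hₜ` inside the disc `r𝕌` lie in `U₁ ⊔ U₂`. [folklore] -/
theorem mem_union_of_mem_domain {U₁ U₂ : Set ℂ}
    (hunion : U₁ ∪ U₂ = (ball 0 r ∩ upperHalfPlaneSet) \ γ '' Icc 0 t) {z : ℂ}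
    (hz : z ∈ domain W t) (hzr : ‖z‖ < r) : z ∈ U₁ ∪ U₂ := by
  rw [hunion]
  exact ⟨⟨by rwa [mem_ball, dist_zero_right], domain_subset W t hz⟩, (hγ.domain_subset_diff t hz).2⟩

omit hW0 hγ hs in
/-- **The side of `fₜ` is locally constant along a real interval.** Let `U, U'` be disjoint
open sets and `J` a preconnected set of reals such that `fₜ` maps the points of `ℍₒ` near each
`v ∈ J` into `U ∪ U'`, and the points near some `v₀ ∈ J` into `U`. Then it maps the points
near EVERY `v ∈ J` into `U` (the set of such `v` and its analogue for `U'` are disjoint,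
relatively open and cover `J`). [folklore] -/
theorem subset_side_of_isPreconnected {U U' : Set ℂ} (hUo : IsOpen U) (hU'o : IsOpen U')
    (hUU' : Disjoint U U') {J : Set ℝ} (hJ : IsPreconnected J)
    (hcover : ∀ v ∈ J, ∃ δ > 0, ∀ w ∈ ball (v : ℂ) δ, w ∈ upperHalfPlaneSet →
      loewnerInv W t w ∈ U ∪ U')
    {v₀ : ℝ} (hv₀ : v₀ ∈ J) (hstart : ∃ δ > 0, ∀ w ∈ ball (v₀ : ℂ) δ, w ∈ upperHalfPlaneSet →
      loewnerInv W t w ∈ U) :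
    ∀ v ∈ J, ∃ δ > 0, ∀ w ∈ ball (v : ℂ) δ, w ∈ upperHalfPlaneSet → loewnerInv W t w ∈ U := by
  set f := loewnerInv W t with hf
  have hfc : ContinuousOn f upperHalfPlaneSet := (differentiableOn_invFunOn_map hW t).continuousOn
  -- the sets of points of each side
  set T : Set ℝ := {v | ∃ δ > 0, ∀ w ∈ ball (v : ℂ) δ, w ∈ upperHalfPlaneSet → f w ∈ U} with hT
  set T' : Set ℝ := {v | ∃ δ > 0, ∀ w ∈ ball (v : ℂ) δ, w ∈ upperHalfPlaneSet → f w ∈ U'} with hT'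
  -- both are open
  have hopen : ∀ (V : Set ℂ), IsOpen {v : ℝ | ∃ δ > 0, ∀ w ∈ ball (v : ℂ) δ,
      w ∈ upperHalfPlaneSet → f w ∈ V} := by
    intro V
    rw [Metric.isOpen_iff]
    rintro v ⟨δ, hδ, hV⟩
    refine ⟨δ / 2, by positivity, fun v' hv' ↦ ⟨δ / 2, by positivity, fun w hw hwH ↦ hV w ?_ hwH⟩⟩
    rw [mem_ball] at hw hv' ⊢
    have : dist (v' : ℂ) (v : ℂ) < δ / 2 := by
      rw [Complex.dist_eq, ← Complex.ofReal_sub, Complex.norm_real, Real.norm_eq_abs, ← Real.dist_eq]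
      exact hv'
    linarith [dist_triangle w (v' : ℂ) (v : ℂ)]
  -- they are disjoint
  have hdisjT : Disjoint T T' := by
    rw [Set.disjoint_left]
    rintro v ⟨δ, hδ, hV⟩ ⟨δ', hδ', hV'⟩
    set w : ℂ := (v : ℂ) + I * ((min δ δ' / 2 : ℝ) : ℂ) with hw
    have hwim : w.im = min δ δ' / 2 := by simp [hw]
    have hwH : w ∈ upperHalfPlaneSet := by
      show 0 < w.im
      rw [hwim]; positivity
    have hwdist : dist w (v : ℂ) = min δ δ' / 2 := by
      rw [dist_eq_norm, hw, add_sub_cancel_left, norm_mul, norm_I, one_mul, Complex.norm_real,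
        Real.norm_eq_abs, abs_of_pos (by positivity)]
    have h1 : f w ∈ U := hV w (by rw [mem_ball, hwdist]; linarith [min_le_left δ δ']) hwH
    have h2 : f w ∈ U' := hV' w (by rw [mem_ball, hwdist]; linarith [min_le_right δ δ']) hwH
    exact Set.disjoint_left.1 hUU' h1 h2
  -- they cover `J`
  have hcov : J ⊆ T ∪ T' := by
    intro v hv
    obtain ⟨δ, hδ, hV⟩ := hcover v hv
    have hpre : IsPreconnected (f '' (ball (v : ℂ) δ ∩ upperHalfPlaneSet)) :=
      ((convex_ball (v : ℂ) δ).inter (convex_halfSpace_im_gt 0)).isPreconnected.image f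
        (hfc.mono inter_subset_right)
    have hsub : f '' (ball (v : ℂ) δ ∩ upperHalfPlaneSet) ⊆ U ∪ U' := by
      rintro _ ⟨w, ⟨hw, hwH⟩, rfl⟩
      exact hV w hw hwH
    rcases hpre.subset_or_subset hUo hU'o hUU' hsub with h | h
    · exact Or.inl ⟨δ, hδ, fun w hw hwH ↦ h ⟨w, ⟨hw, hwH⟩, rfl⟩⟩
    · exact Or.inr ⟨δ, hδ, fun w hw hwH ↦ h ⟨w, ⟨hw, hwH⟩, rfl⟩⟩
  -- connectedness
  rcases hJ.subset_or_subset (hopen U) (hopen U') hdisjT hcov with h | h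
  · exact fun v hv ↦ h hv
  · exact absurd hstart (Set.disjoint_left.1 hdisjT.symm (h hv₀) |> fun hn ↦ fun hs' ↦ hn hs')

variable {U₁ U₂ : Set ℂ}

/-- `fₜ` maps the points of `ℍₒ` near a real `v ∈ (Wₜ, gₜ r)` into the right side `U₁`.
[folklore] -/
theorem subset_right_of_mem_Ioo (hr : 0 < r) (hex : IsExitTime W r t) (hU₁o : IsOpen U₁)
    (hU₂o : IsOpen U₂) (hdisj : Disjoint U₁ U₂)
    (hunion : U₁ ∪ U₂ = (ball 0 r ∩ upperHalfPlaneSet) \ γ '' Icc 0 t)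
    (hf₂ : frontier U₂ ⊆ γ '' Icc 0 t ∪ {z : ℂ | ‖z‖ = r ∨ (z.im = 0 ∧ z.re ≤ 0)}) {v : ℝ}
    (hv : v ∈ Ioo (W t) (map W t r).re) :
    ∃ δ > 0, ∀ w ∈ ball (v : ℂ) δ, w ∈ upperHalfPlaneSet → loewnerInv W t w ∈ U₁ := by
  -- general covering property on the interval
  have hcover : ∀ v ∈ Ioo (W t) (map W t r).re, ∃ δ > 0, ∀ w ∈ ball (v : ℂ) δ,
      w ∈ upperHalfPlaneSet → loewnerInv W t w ∈ U₁ ∪ U₂ := by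
    intro v hv
    have hlt := norm_bdryInv_lt_of_mem_Ioo_right hW hW0 hγ hs hr hex hv
    have hcont : ContinuousWithinAt (bdryInv W t) {z : ℂ | 0 ≤ z.im} (v : ℂ) :=
      hγ.continuousOn_bdryInv hW t _ (by simp)
    have hev : ∀ᶠ w in 𝓝[{z : ℂ | 0 ≤ z.im}] (v : ℂ), ‖bdryInv W t w‖ < r :=
      hcont.norm (gt_mem_nhds hlt)
    obtain ⟨δ, hδ, hball⟩ := Metric.mem_nhdsWithin_iff.1 hev
    refine ⟨δ, hδ, fun w hw hwH ↦ ?_⟩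
    have hwr : ‖bdryInv W t w‖ < r := hball ⟨hw, (le_of_lt hwH : (0 : ℝ) ≤ w.im)⟩
    rw [bdryInv_eq_of_mem hW t hwH] at hwr
    exact mem_union_of_mem_domain hγ hunion ((bijOn_invFunOn_map hW t).mapsTo hwH) hwr
  -- the point `v₀ = gₜ(r/2)` and the near-arc lemma
  have hr2 : (0 : ℝ) < r / 2 := by positivity
  set v₀ : ℝ := (map W t ((r / 2 : ℝ) : ℂ)).re with hv₀
  have hmono := map_ofReal_re_strictMonoOn_pos_of_isSimpleTrace hW hW0 hγ hs t
  have hv₀mem : v₀ ∈ Ioo (W t) (map W t r).re :=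
    ⟨driving_lt_map_ofReal_re_of_isSimpleTrace hW hW0 hγ hs hr2 t, hmono hr2 hr (by linarith)⟩
  have hval : bdryInv W t v₀ = ((r / 2 : ℝ) : ℂ) := by
    rw [hv₀, ← map_ofReal_eq_of_isSimpleTrace hW hW0 hγ hs hr2.ne' t]
    exact bdryInv_map_ofReal hW hW0 hγ hs hr2.ne' t
  have hqL : ((r / 2 : ℝ) : ℂ) ∉ γ '' Icc 0 t := ofReal_notMem_image_of_isSimpleTrace hW0 hγ hs hr2.ne' t
  obtain ⟨δ₁, hδ₁, hnear⟩ :=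
    Literature.Topology.PlaneTopology.subset_right_of_near hunion hf₂ hr2 (by linarith) hqL
  have hstart : ∃ δ > 0, ∀ w ∈ ball (v₀ : ℂ) δ, w ∈ upperHalfPlaneSet → loewnerInv W t w ∈ U₁ := by
    have hcont : ContinuousWithinAt (bdryInv W t) {z : ℂ | 0 ≤ z.im} (v₀ : ℂ) :=
      hγ.continuousOn_bdryInv hW t _ (by simp)
    have hev : ∀ᶠ w in 𝓝[{z : ℂ | 0 ≤ z.im}] (v₀ : ℂ),
        bdryInv W t w ∈ ball ((r / 2 : ℝ) : ℂ) (min δ₁ (r / 2)) := by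
      have hpos : 0 < min δ₁ (r / 2) := lt_min hδ₁ (by positivity)
      have h : ball ((r / 2 : ℝ) : ℂ) (min δ₁ (r / 2)) ∈ 𝓝 (bdryInv W t v₀) := by
        rw [hval]
        exact ball_mem_nhds _ hpos
      exact hcont h
    obtain ⟨δ, hδ, hball⟩ := Metric.mem_nhdsWithin_iff.1 hev
    refine ⟨δ, hδ, fun w hw hwH ↦ ?_⟩
    have hmem : bdryInv W t w ∈ ball ((r / 2 : ℝ) : ℂ) (min δ₁ (r / 2)) := hball ⟨hw, (le_of_lt hwH : (0 : ℝ) ≤ w.im)⟩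
    rw [bdryInv_eq_of_mem hW t hwH] at hmem
    have hfw : loewnerInv W t w ∈ domain W t := (bijOn_invFunOn_map hW t).mapsTo hwH
    refine hnear ⟨ball_subset_ball (min_le_left _ _) hmem, ⟨?_, domain_subset W t hfw⟩,
      (hγ.domain_subset_diff t hfw).2⟩
    rw [mem_ball, dist_zero_right]
    have h1 : dist (loewnerInv W t w) ((r / 2 : ℝ) : ℂ) < r / 2 :=
      lt_of_lt_of_le (mem_ball.1 hmem) (min_le_right _ _)
    calc ‖loewnerInv W t w‖ = ‖(loewnerInv W t w - ((r / 2 : ℝ) : ℂ)) + ((r / 2 : ℝ) : ℂ)‖ := by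
          rw [sub_add_cancel]
      _ ≤ ‖loewnerInv W t w - ((r / 2 : ℝ) : ℂ)‖ + ‖((r / 2 : ℝ) : ℂ)‖ := norm_add_le _ _
      _ < r / 2 + r / 2 := by
          rw [← dist_eq_norm, Complex.norm_real, Real.norm_eq_abs, abs_of_pos hr2]; linarith
      _ = r := by ring
  exact subset_side_of_isPreconnected hW hU₁o hU₂o hdisj isPreconnected_Ioo hcover hv₀mem hstart v hv

/-- `fₜ` maps the points of `ℍₒ` near a real `v ∈ (gₜ(-r), Wₜ)` into the left side `U₂`.
[folklore] -/
theorem subset_left_of_mem_Ioo (hr : 0 < r) (hex : IsExitTime W r t) (hU₁o : IsOpen U₁)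
    (hU₂o : IsOpen U₂) (hdisj : Disjoint U₁ U₂)
    (hunion : U₁ ∪ U₂ = (ball 0 r ∩ upperHalfPlaneSet) \ γ '' Icc 0 t)
    (hf₁ : frontier U₁ ⊆ γ '' Icc 0 t ∪ {z : ℂ | ‖z‖ = r ∨ (z.im = 0 ∧ 0 ≤ z.re)}) {v : ℝ}
    (hv : v ∈ Ioo (map W t ((-r : ℝ) : ℂ)).re (W t)) :
    ∃ δ > 0, ∀ w ∈ ball (v : ℂ) δ, w ∈ upperHalfPlaneSet → loewnerInv W t w ∈ U₂ := by
  have hcover : ∀ v ∈ Ioo (map W t ((-r : ℝ) : ℂ)).re (W t), ∃ δ > 0, ∀ w ∈ ball (v : ℂ) δ,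
      w ∈ upperHalfPlaneSet → loewnerInv W t w ∈ U₂ ∪ U₁ := by
    intro v hv
    have hlt := norm_bdryInv_lt_of_mem_Ioo_left hW hW0 hγ hs hr hex hv
    have hcont : ContinuousWithinAt (bdryInv W t) {z : ℂ | 0 ≤ z.im} (v : ℂ) :=
      hγ.continuousOn_bdryInv hW t _ (by simp)
    have hev : ∀ᶠ w in 𝓝[{z : ℂ | 0 ≤ z.im}] (v : ℂ), ‖bdryInv W t w‖ < r :=
      hcont.norm (gt_mem_nhds hlt)
    obtain ⟨δ, hδ, hball⟩ := Metric.mem_nhdsWithin_iff.1 hev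
    refine ⟨δ, hδ, fun w hw hwH ↦ ?_⟩
    have hwr : ‖bdryInv W t w‖ < r := hball ⟨hw, (le_of_lt hwH : (0 : ℝ) ≤ w.im)⟩
    rw [bdryInv_eq_of_mem hW t hwH] at hwr
    rw [union_comm]
    exact mem_union_of_mem_domain hγ hunion ((bijOn_invFunOn_map hW t).mapsTo hwH) hwr
  have hr2 : -(r / 2) < (0 : ℝ) := by linarith
  have hr2' : (-(r / 2) : ℝ) ≠ 0 := hr2.ne
  set v₀ : ℝ := (map W t ((-(r / 2) : ℝ) : ℂ)).re with hv₀
  have hmono := map_ofReal_re_strictMonoOn_neg_of_isSimpleTrace hW hW0 hγ hs t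
  have hv₀mem : v₀ ∈ Ioo (map W t ((-r : ℝ) : ℂ)).re (W t) := by
    refine ⟨?_, map_ofReal_re_lt_driving_of_isSimpleTrace hW hW0 hγ hs hr2 t⟩
    have := hmono (show (-r : ℝ) ∈ Iio 0 by simp [hr]) (show (-(r / 2) : ℝ) ∈ Iio 0 from hr2)
      (by linarith)
    exact this
  have hval : bdryInv W t v₀ = ((-(r / 2) : ℝ) : ℂ) := by
    rw [hv₀, ← map_ofReal_eq_of_isSimpleTrace hW hW0 hγ hs hr2' t]
    exact bdryInv_map_ofReal hW hW0 hγ hs hr2' t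
  have hqL : ((-(r / 2) : ℝ) : ℂ) ∉ γ '' Icc 0 t := ofReal_notMem_image_of_isSimpleTrace hW0 hγ hs hr2' t
  obtain ⟨δ₁, hδ₁, hnear⟩ :=
    Literature.Topology.PlaneTopology.subset_left_of_near hunion hf₁ hr2 (by linarith) hqL
  have hstart : ∃ δ > 0, ∀ w ∈ ball (v₀ : ℂ) δ, w ∈ upperHalfPlaneSet → loewnerInv W t w ∈ U₂ := by
    have hcont : ContinuousWithinAt (bdryInv W t) {z : ℂ | 0 ≤ z.im} (v₀ : ℂ) :=
      hγ.continuousOn_bdryInv hW t _ (by simp)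
    have hev : ∀ᶠ w in 𝓝[{z : ℂ | 0 ≤ z.im}] (v₀ : ℂ),
        bdryInv W t w ∈ ball ((-(r / 2) : ℝ) : ℂ) (min δ₁ (r / 2)) := by
      have hpos : 0 < min δ₁ (r / 2) := lt_min hδ₁ (by positivity)
      have h : ball ((-(r / 2) : ℝ) : ℂ) (min δ₁ (r / 2)) ∈ 𝓝 (bdryInv W t v₀) := by
        rw [hval]
        exact ball_mem_nhds _ hpos
      exact hcont h
    obtain ⟨δ, hδ, hball⟩ := Metric.mem_nhdsWithin_iff.1 hev
    refine ⟨δ, hδ, fun w hw hwH ↦ ?_⟩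
    have hmem : bdryInv W t w ∈ ball ((-(r / 2) : ℝ) : ℂ) (min δ₁ (r / 2)) := hball ⟨hw, (le_of_lt hwH : (0 : ℝ) ≤ w.im)⟩
    rw [bdryInv_eq_of_mem hW t hwH] at hmem
    have hfw : loewnerInv W t w ∈ domain W t := (bijOn_invFunOn_map hW t).mapsTo hwH
    refine hnear ⟨ball_subset_ball (min_le_left _ _) hmem, ⟨?_, domain_subset W t hfw⟩,
      (hγ.domain_subset_diff t hfw).2⟩
    rw [mem_ball, dist_zero_right]
    have h1 : dist (loewnerInv W t w) ((-(r / 2) : ℝ) : ℂ) < r / 2 :=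
      lt_of_lt_of_le (mem_ball.1 hmem) (min_le_right _ _)
    have h2 : ‖((-(r / 2) : ℝ) : ℂ)‖ = r / 2 := by
      rw [Complex.norm_real, Real.norm_eq_abs, abs_of_neg hr2]; ring
    calc ‖loewnerInv W t w‖ = ‖(loewnerInv W t w - ((-(r / 2) : ℝ) : ℂ)) + ((-(r / 2) : ℝ) : ℂ)‖ := by
          rw [sub_add_cancel]
      _ ≤ ‖loewnerInv W t w - ((-(r / 2) : ℝ) : ℂ)‖ + ‖((-(r / 2) : ℝ) : ℂ)‖ := norm_add_le _ _
      _ < r / 2 + r / 2 := by rw [← dist_eq_norm, h2]; linarith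
      _ = r := by ring
  have h := subset_side_of_isPreconnected hW hU₂o hU₁o hdisj.symm isPreconnected_Ioo hcover hv₀mem
    hstart v hv
  exact h

/-! ### Every semicircle about `Wₜ` is mapped onto a curve reaching the circle `|z| = r` -/

/-- **A semicircle about the driving point reaches the rim**: for `0 < s` with
`Wₜ + s < gₜ r`, some point of the closed upper semicircle of radius `s` about `Wₜ` has
`|f̄ₜ| ≥ r`. Otherwise `θ ↦ f̄ₜ(Wₜ + s e^{iθ})` would run, for `θ ∈ (0, π)`, inside
`U₁ ⊔ U₂`, starting in `U₁` (near the real point `Wₜ + s`, `subset_right_of_mem_Ioo`) and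
ending in `U₂` (near `Wₜ - s`: if `Wₜ - s ≤ gₜ(-r)` the endpoint itself has `|f̄ₜ| ≥ r`,
`le_norm_bdryInv_of_le_left`; otherwise `subset_left_of_mem_Ioo`). This is the topological
heart of the extremal-length comparison in [LSW] Lemma 6.2 (curves from `Ã` to `(-∞, W]`
pull back to curves reaching `|z| = r`). [cite: LawlerSchrammWerner2003Restriction, proof of Lemma 6.2] -/
theorem exists_le_norm_bdryInv_circleMap (hr : 0 < r) (hex : IsExitTime W r t) {s : ℝ}
    (hs0 : 0 < s) (hsr : W t + s < (map W t r).re) :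
    ∃ θ ∈ Icc (0 : ℝ) π, r ≤ ‖bdryInv W t (circleMap (W t : ℂ) s θ)‖ := by
  by_contra hcon
  push Not at hcon
  obtain ⟨U₁, U₂, hU₁o, hU₂o, hdisj, hunion, hf₁, hf₂⟩ := exists_sides_exitTime hW hW0 hγ hs hr hex
  set Φ : ℝ → ℂ := fun θ ↦ bdryInv W t (circleMap (W t : ℂ) s θ) with hΦ
  -- continuity of `Φ` on `[0, π]`
  have him : ∀ θ ∈ Icc (0 : ℝ) π, 0 ≤ (circleMap (W t : ℂ) s θ).im := fun θ hθ ↦ by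
    rw [Literature.Analysis.Complex.AnnulusCrossing.circleMap_ofReal_im]
    exact mul_nonneg hs0.le (Real.sin_nonneg_of_mem_Icc hθ)
  have hΦc : ContinuousOn Φ (Icc 0 π) :=
    (hγ.continuousOn_bdryInv hW t).comp (continuous_circleMap _ _).continuousOn him
  -- interior points go to `U₁ ∪ U₂`
  have hmemH : ∀ θ ∈ Ioo (0 : ℝ) π, circleMap (W t : ℂ) s θ ∈ upperHalfPlaneSet := fun θ hθ ↦
    Literature.Analysis.Complex.AnnulusCrossing.circleMap_mem_upperHalfPlaneSet (W t) hs0 hθ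
  have hΦeq : ∀ θ ∈ Ioo (0 : ℝ) π, Φ θ = loewnerInv W t (circleMap (W t : ℂ) s θ) := fun θ hθ ↦
    bdryInv_eq_of_mem hW t (hmemH θ hθ)
  have hsub : ∀ θ ∈ Ioo (0 : ℝ) π, Φ θ ∈ U₁ ∪ U₂ := by
    intro θ hθ
    rw [hΦeq θ hθ]
    refine mem_union_of_mem_domain hγ hunion ((bijOn_invFunOn_map hW t).mapsTo (hmemH θ hθ)) ?_
    rw [← hΦeq θ hθ]
    exact hcon θ (Ioo_subset_Icc_self hθ)
  -- near `θ = 0`: in `U₁`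
  obtain ⟨δ₁, hδ₁, hright⟩ := subset_right_of_mem_Ioo hW hW0 hγ hs hr hex hU₁o hU₂o hdisj hunion hf₂
    (v := W t + s) ⟨by linarith, hsr⟩
  have hstart : ∃ θ₁ ∈ Ioo (0 : ℝ) π, Φ θ₁ ∈ U₁ := by
    have hc0 : ContinuousAt (circleMap (W t : ℂ) s) 0 := (continuous_circleMap _ _).continuousAt
    have h0 : circleMap (W t : ℂ) s 0 = ((W t + s : ℝ) : ℂ) := by
      rw [circleMap]; push_cast; simp
    have hev : ∀ᶠ θ in 𝓝 (0 : ℝ), circleMap (W t : ℂ) s θ ∈ ball (((W t + s : ℝ) : ℂ)) δ₁ := by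
      refine hc0 ?_
      rw [h0]
      exact ball_mem_nhds _ hδ₁
    obtain ⟨ρ, hρ, hρball⟩ := Metric.eventually_nhds_iff.1 hev
    set θ₁ : ℝ := min (π / 2) (ρ / 2) with hθ₁
    have hθ₁mem : θ₁ ∈ Ioo (0 : ℝ) π :=
      ⟨lt_min (by positivity) (by positivity), (min_le_left _ _).trans_lt (by linarith [Real.pi_pos])⟩
    refine ⟨θ₁, hθ₁mem, ?_⟩
    rw [hΦeq θ₁ hθ₁mem]
    refine hright _ (hρball ?_) (hmemH θ₁ hθ₁mem)
    rw [Real.dist_eq, sub_zero, abs_of_pos hθ₁mem.1]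
    exact (min_le_right _ _).trans_lt (by linarith)
  -- near `θ = π`: in `U₂`
  have hend : ∃ θ₂ ∈ Ioo (0 : ℝ) π, Φ θ₂ ∈ U₂ := by
    have hπ : circleMap (W t : ℂ) s π = ((W t - s : ℝ) : ℂ) := by
      rw [circleMap, Complex.exp_pi_mul_I]; push_cast; ring
    rcases le_or_gt (W t - s) (map W t ((-r : ℝ) : ℂ)).re with hle | hgt
    · -- the endpoint already has `|f̄ₜ| ≥ r`
      exfalso
      have h := le_norm_bdryInv_of_le_left hW hW0 hγ hs hr hle
      have h' := hcon π ⟨Real.pi_pos.le, le_rfl⟩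
      rw [hπ] at h'
      exact absurd h (not_le.2 h')
    · obtain ⟨δ₂, hδ₂, hleft⟩ := subset_left_of_mem_Ioo hW hW0 hγ hs hr hex hU₁o hU₂o hdisj hunion
        hf₁ (v := W t - s) ⟨hgt, by linarith⟩
      have hcπ : ContinuousAt (circleMap (W t : ℂ) s) π := (continuous_circleMap _ _).continuousAt
      have hev : ∀ᶠ θ in 𝓝 π, circleMap (W t : ℂ) s θ ∈ ball (((W t - s : ℝ) : ℂ)) δ₂ := by
        refine hcπ ?_
        rw [hπ]
        exact ball_mem_nhds _ hδ₂
      obtain ⟨ρ, hρ, hρball⟩ := Metric.eventually_nhds_iff.1 hev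
      set θ₂ : ℝ := π - min (π / 2) (ρ / 2) with hθ₂
      have hmin : 0 < min (π / 2) (ρ / 2) := lt_min (by positivity) (by positivity)
      have hθ₂mem : θ₂ ∈ Ioo (0 : ℝ) π := by
        constructor
        · have : min (π / 2) (ρ / 2) ≤ π / 2 := min_le_left _ _
          rw [hθ₂]; linarith [Real.pi_pos]
        · rw [hθ₂]; linarith
      refine ⟨θ₂, hθ₂mem, ?_⟩
      rw [hΦeq θ₂ hθ₂mem]
      refine hleft _ (hρball ?_) (hmemH θ₂ hθ₂mem)
      rw [Real.dist_eq, hθ₂, show π - min (π / 2) (ρ / 2) - π = -min (π / 2) (ρ / 2) by ring,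
        abs_neg, abs_of_pos hmin]
      exact (min_le_right _ _).trans_lt (by linarith)
  obtain ⟨θ₁, hθ₁, hU⟩ := hstart
  obtain ⟨θ₂, hθ₂, hV⟩ := hend
  exact not_mem_and_mem_of_continuousOn (hΦc.mono Ioo_subset_Icc_self) hU₁o hU₂o hdisj hsub hθ₁ hθ₂
    hU hV

end ExitTime

/-! ### [LSW] Lemma 6.2 for simple curves -/

/-- NAMED FACT — **[LSW] Lemma 6.2 for chains from the origin generated by a simple curve**:
as `Loewner.restrictionDeriv_exitTime_gt` (the printed Lemma 6.2: for `A ∈ 𝒬₊` never met by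
the closed hulls, `g'_{A_t}(W_t) = Φ'_{A_t − W_t}(0) > 1 − ε` at every exit time `t = T(r)` of a
large disc `r𝕌`), restricted to continuous driving functions with `W 0 = 0` whose chain is
generated by a SIMPLE curve (`IsGeneratedByCurve`, `IsSimpleTrace`) — the case of the SLE_κ
traces, `κ ≤ 4`, in particular of SLE_{8/3} in the proof of [LSW] Thm. 6.1. Weaker than
`restrictionDeriv_exitTime_gt` (`restrictionDeriv_exitTime_gt.simple`) and PROVED below
(`restrictionDeriv_exitTime_gt_simple_holds`). [cite: LawlerSchrammWerner2003Restriction, Lemma 6.2] -/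
def restrictionDeriv_exitTime_gt_simple : Prop :=
  ∀ {W : ℝ≥0 → ℝ}, Continuous W → W 0 = 0 → ∀ {γ : ℝ≥0 → ℂ}, IsGeneratedByCurve W γ →
    IsSimpleTrace γ → ∀ {A : Set ℂ}, IsPlusHull A → (∀ t, Disjoint (closedHull W t) A) →
      ∀ ε : ℝ, 0 < ε → ∃ r₀ : ℝ, ∀ r : ℝ, r₀ ≤ r → ∀ t : ℝ≥0, IsExitTime W r t →
        ∀ (Ψ : ConformalEquiv (upperHalfPlaneSet \ slidHull W A t) upperHalfPlaneSet) (e : ℝ),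
          IsRestrictionMap (slidHull W A t) Ψ → HasRestrictionDeriv (slidHull W A t) Ψ e →
            1 - ε < e

/-- The printed Lemma 6.2 implies its simple-curve case. [folklore] -/
theorem restrictionDeriv_exitTime_gt.simple (h62 : restrictionDeriv_exitTime_gt) :
    restrictionDeriv_exitTime_gt_simple :=
  fun hW _ _ _ _ _ hA hdisj ε hε ↦ h62 hW hA hdisj ε hε

section Main

variable {W : ℝ≥0 → ℝ} {γ : ℝ≥0 → ℂ} {A : Set ℂ}
variable (hW : Continuous W) (hW0 : W 0 = 0) (hγ : IsGeneratedByCurve W γ) (hs : IsSimpleTrace γ)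
include hW hW0 hγ hs

/-- **The geometric core of [LSW] Lemma 6.2**: given `δ > 0`, for every large `r` and every exit
time `t = T(r)`, the slid hull `A_t − W_t` of a nonempty `+`-hull `A` never met by the closed
hulls lies in a closed disc `D̄(p, m)` about a real point `p > 0` with `m ≤ δ p` ("`diam(Ã) /
inf{|W − z| : z ∈ Ã}` goes to zero"). See the module docstring for the proof.
[cite: LawlerSchrammWerner2003Restriction, proof of Lemma 6.2] -/
theorem exists_slidHull_subset_closedBall (hA : IsPlusHull A) (hne : A.Nonempty)
    (hdisj : ∀ t, Disjoint (closedHull W t) A) {δ : ℝ} (hδ : 0 < δ) :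
    ∃ r₀ : ℝ, ∀ r : ℝ, r₀ ≤ r → ∀ t : ℝ≥0, IsExitTime W r t →
      ∃ p m : ℝ, 0 < p ∧ 0 ≤ m ∧ m ≤ δ * p ∧ slidHull W A t ⊆ closedBall (p : ℂ) m := by
  classical
  -- the hull: leftmost real point `a₀`, radius `R₀`, connected `A' = A ∪ [a₀, R₀]`
  obtain ⟨a₀, ha₀, ha₀A, hmin⟩ := hA.exists_min_ofReal hne
  have hAb := hA.1.isBoundedHull
  obtain ⟨R, hR⟩ := hAb.1.subset_closedBall 0
  set R₀ : ℝ := max R a₀ with hR₀def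
  have hR₀pos : 0 < R₀ := lt_of_lt_of_le ha₀ (le_max_right _ _)
  have ha₀R₀ : a₀ ≤ R₀ := le_max_right _ _
  have hAnorm : ∀ z ∈ A, ‖z‖ ≤ R₀ := fun z hz ↦ by
    have := hR hz
    rw [mem_closedBall, dist_zero_right] at this
    exact this.trans (le_max_left _ _)
  have hreal : ∀ x : ℝ, (x : ℂ) ∈ A → x ∈ Icc a₀ R₀ := fun x hx ↦
    ⟨hmin x hx, by
      have h := hAnorm _ hx
      rw [Complex.norm_real, Real.norm_eq_abs] at h
      exact (le_abs_self x).trans h⟩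
  set A' : Set ℂ := A ∪ Complex.ofReal '' Icc a₀ R₀ with hA'def
  have hA'conn : IsConnected A' := hAb.isConnected_union_ofReal_image ha₀R₀ hreal
  have hA'cpt : IsCompact A' := hAb.isCompact.union (isCompact_Icc.image Complex.continuous_ofReal)
  have ha₀A' : (a₀ : ℂ) ∈ A' := Or.inl ha₀A
  have hA'norm : ∀ z ∈ A', ‖z‖ ≤ R₀ := by
    rintro z (hz | ⟨x, hx, rfl⟩)
    · exact hAnorm z hz
    · rw [Complex.norm_real, Real.norm_eq_abs, abs_of_pos (ha₀.trans_le hx.1)]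
      exact hx.2
  -- the threshold `r₀`
  set δ₂ : ℝ := min δ (1 / 4) with hδ₂
  have hδ₂pos : 0 < δ₂ := lt_min hδ (by norm_num)
  set L₀ : ℝ := (2 * π ^ 2 + 4 * π ^ 2 / δ₂) / Real.log 2 + 1 with hL₀
  have hlog2 : 0 < Real.log 2 := Real.log_pos (by norm_num)
  have hL₀pos : 0 < L₀ := by positivity
  set r₀ : ℝ := max (64 * R₀ + 1) (R₀ * (4 * Real.exp L₀) ^ 2) with hr₀
  refine ⟨r₀, fun r hr t hex ↦ ?_⟩
  -- consequences of `r ≥ r₀`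
  have hr64 : 64 * R₀ + 1 ≤ r := (le_max_left _ _).trans hr
  have hrpos : 0 < r := by nlinarith
  have hR₀r : R₀ < r := by nlinarith
  have hrexp : R₀ * (4 * Real.exp L₀) ^ 2 ≤ r := (le_max_right _ _).trans hr
  set R₁ : ℝ := 2 * R₀ with hR₁
  set R₃ : ℝ := Real.sqrt (R₀ * r) with hR₃
  set R₂ : ℝ := R₃ / 2 with hR₂
  set R₄ : ℝ := r / 2 with hR₄
  have hR₃pos : 0 < R₃ := Real.sqrt_pos.2 (by positivity)
  have hR₃sq : R₃ ^ 2 = R₀ * r := Real.sq_sqrt (by positivity)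
  have hQ : Real.exp L₀ ≤ R₂ / R₁ := by
    -- `R₃ ≥ 4 R₀ e^{L₀}`
    have h1 : R₀ * (4 * Real.exp L₀) ≤ R₃ := by
      rw [hR₃, ← Real.sqrt_sq (by positivity : 0 ≤ R₀ * (4 * Real.exp L₀))]
      exact Real.sqrt_le_sqrt (by nlinarith [Real.exp_pos L₀])
    rw [hR₂, hR₁, le_div_iff₀ (by positivity)]
    linarith
  have hexp1 : 1 < Real.exp L₀ := by
    have := Real.add_one_le_exp L₀
    linarith
  have hR₁₂ : R₁ < R₂ := by
    have : 1 < R₂ / R₁ := hexp1.trans_le hQ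
    rwa [one_lt_div (by positivity)] at this
  have hR₃₄ : R₃ < R₄ := by
    rw [hR₄]
    nlinarith
  set Lr : ℝ := Real.log (R₂ / R₁) with hLr
  have hLrL₀ : L₀ ≤ Lr := by
    rw [hLr, ← Real.log_exp L₀]
    exact Real.log_le_log (Real.exp_pos _) hQ
  have hLrpos : 0 < Lr := hL₀pos.trans_le hLrL₀
  have hL₂ : Lr ≤ Real.log (R₄ / R₃) := by
    refine Real.log_le_log (by positivity) ?_
    rw [hR₂, hR₄, hR₁, div_le_div_iff₀ (by positivity) (by positivity)]
    nlinarith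
  -- the chain at time `t`
  have ht := exitTime_pos hW hW0 hγ hs hrpos hex
  set g : ℂ → ℂ := map W t with hg
  set c : ℝ := W t with hc
  -- points of `A'`: in `Hₜ` or positive reals
  have hcases : ∀ z ∈ A', z ∈ domain W t ∨ ∃ x : ℝ, 0 < x ∧ z = x := by
    intro z hz
    rcases hz with hzA | ⟨x, hx, rfl⟩
    · rcases (hAb.im_nonneg hzA).eq_or_lt with h0 | hpos
      · right
        refine ⟨z.re, ?_, ?_⟩
        · have hz' : z = ((z.re : ℝ) : ℂ) := by
            rw [← Complex.re_add_im z, ← h0]; simp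
          rw [hz'] at hzA
          exact ha₀.trans_le (hmin _ hzA)
        · rw [← Complex.re_add_im z, ← h0]; simp
      · left
        refine ⟨hpos, fun hhull ↦ ?_⟩
        exact Set.disjoint_left.1 (hdisj t) (hull_subset_closedHull W t hhull) hzA
    · exact Or.inr ⟨x, ha₀.trans_le hx.1, rfl⟩
  have hgc : ContinuousOn g A' := by
    intro z hz
    rcases hcases z hz with h | ⟨x, hx, rfl⟩
    · exact (continuousAt_map hW ((mem_domain_iff W t _).1 h).2).continuousWithinAt
    · exact (continuousAt_map_ofReal_of_isSimpleTrace hW hW0 hγ hs hx.ne' t).continuousWithinAt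
  have hginv : ∀ z ∈ A', bdryInv W t (g z) = z := by
    intro z hz
    rcases hcases z hz with h | ⟨x, hx, rfl⟩
    · exact bdryInv_map hW t h
    · exact bdryInv_map_ofReal hW hW0 hγ hs hx.ne' t
  have hgim : ∀ z ∈ A', 0 ≤ (g z).im := by
    intro z hz
    rcases hcases z hz with h | ⟨x, hx, rfl⟩
    · exact (mapsTo_map hW t h).le
    · exact (map_ofReal_im_of_isSimpleTrace hW hW0 hγ hs hx.ne' t).ge
  -- the centre `p` and the distance function `φ`
  set p : ℝ := (g a₀).re - c with hp
  have hppos : 0 < p := by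
    have := driving_lt_map_ofReal_re_of_isSimpleTrace hW hW0 hγ hs ha₀ t
    rw [hp]; linarith
  have hga₀ : g a₀ = ((p + c : ℝ) : ℂ) := by
    rw [hp, sub_add_cancel]
    exact map_ofReal_eq_of_isSimpleTrace hW hW0 hγ hs ha₀.ne' t
  set φ : ℂ → ℝ := fun z ↦ ‖g z - c - p‖ with hφ
  have hφc : ContinuousOn φ A' := ((hgc.sub continuousOn_const).sub continuousOn_const).norm
  have hφa₀ : φ a₀ = 0 := by
    simp only [hφ, hga₀]
    push_cast
    ring_nf
    simp
  obtain ⟨zmax, hzmaxA', hzmax⟩ := hA'cpt.exists_isMaxOn ⟨_, ha₀A'⟩ hφc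
  set m : ℝ := φ zmax with hm
  have hm0 : 0 ≤ m := norm_nonneg _
  have hmle : ∀ z ∈ A', φ z ≤ m := fun z hz ↦ hzmax hz
  -- the slid hull lies in `D̄(p, m)`
  have hsub : slidHull W A t ⊆ closedBall (p : ℂ) m := by
    rintro _ ⟨z, hz, rfl⟩
    rw [mem_closedBall, dist_eq_norm]
    exact hmle z (Or.inl hz)
  refine ⟨p, m, hppos, hm0, ?_, hsub⟩
  -- KEY: `m ≤ δ p`, by the length–area inequality
  rcases hm0.eq_or_lt with hm00 | hmpos
  · rw [← hm00]; positivity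
  set m' : ℝ := min m (p / 2) with hm'
  have hm'pos : 0 < m' := lt_min hmpos (by positivity)
  have hm'p : m' < p := (min_le_right _ _).trans_lt (by linarith)
  have hm'm : m' ≤ m := min_le_left _ _
  -- the shifted inverse `fT w = f̄ₜ (w + Wₜ)`
  set fT : ℂ → ℂ := fun w ↦ bdryInv W t (w + c) with hfT
  have hshift : ∀ w : ℂ, w ∈ upperHalfPlaneSet ↔ w + c ∈ upperHalfPlaneSet := fun w ↦ by
    simp [upperHalfPlaneSet]
  have hfTeq : ∀ w ∈ upperHalfPlaneSet, fT w = loewnerInv W t (w + c) := fun w hw ↦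
    bdryInv_eq_of_mem hW t ((hshift w).1 hw)
  have hf : DifferentiableOn ℂ fT upperHalfPlaneSet := by
    refine DifferentiableOn.congr ?_ hfTeq
    exact (differentiableOn_invFunOn_map hW t).comp (differentiableOn_id.add_const _)
      fun w hw ↦ (hshift w).1 hw
  have hinj : InjOn fT upperHalfPlaneSet := by
    intro w₁ hw₁ w₂ hw₂ h
    rw [hfTeq w₁ hw₁, hfTeq w₂ hw₂] at h
    have := (bijOn_invFunOn_map hW t).injOn ((hshift w₁).1 hw₁) ((hshift w₂).1 hw₂) h
    exact add_right_cancel this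
  -- continuity of `fT` along closed upper semicircles about real centres
  have hfTc : ∀ (q u : ℝ), 0 < u → ContinuousOn (fun θ ↦ fT (circleMap (q : ℂ) u θ)) (Icc 0 π) := by
    intro q u hu
    have him : ∀ θ ∈ Icc (0 : ℝ) π, circleMap (q : ℂ) u θ + c ∈ {z : ℂ | 0 ≤ z.im} := fun θ hθ ↦ by
      show 0 ≤ (circleMap (q : ℂ) u θ + c).im
      rw [add_im, ofReal_im, add_zero, Literature.Analysis.Complex.AnnulusCrossing.circleMap_ofReal_im]
      exact mul_nonneg hu.le (Real.sin_nonneg_of_mem_Icc hθ)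
    exact (hγ.continuousOn_bdryInv hW t).comp ((continuous_circleMap _ _).add continuous_const).continuousOn him
  -- `g a₀ < g r` and the comparison of the junction with the semicircle lemma
  have ha₀r : a₀ < r := ha₀R₀.trans_lt hR₀r
  have hga₀r : (g a₀).re < (map W t r).re := map_ofReal_re_strictMonoOn_pos_of_isSimpleTrace hW hW0 hγ hs t ha₀ hrpos ha₀r
  -- the crossing dichotomy for every `u ∈ (m'/2, m')`
  have hcross : ∀ u ∈ Ioo (m' / 2) m',
      (∃ θ' ∈ Ioo (0 : ℝ) π, ∃ θ'' ∈ Ioo (0 : ℝ) π,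
        ‖fT (circleMap (p : ℂ) u θ')‖ < R₁ ∧ R₂ < ‖fT (circleMap (p : ℂ) u θ'')‖) ∨
      (∃ θ' ∈ Ioo (0 : ℝ) π, ∃ θ'' ∈ Ioo (0 : ℝ) π,
        ‖fT (circleMap 0 (p - u) θ')‖ < R₃ ∧ R₄ < ‖fT (circleMap 0 (p - u) θ'')‖) := by
    intro u hu
    have hu0 : 0 < u := (half_pos hm'pos).trans hu.1
    have hum : u ≤ m := hu.2.le.trans hm'm
    have hup : u < p := hu.2.trans hm'p
    -- a point of `Ã` on the circle of radius `u` about `p`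
    obtain ⟨zs, hzsA', hzsφ⟩ : ∃ zs ∈ A', φ zs = u := by
      have h := hA'conn.isPreconnected.intermediate_value ha₀A' hzmaxA' hφc
      rw [hφa₀] at h
      exact h ⟨hu0.le, hum⟩
    set ws : ℂ := g zs - c with hws
    have hwsu : ‖ws - p‖ = u := hzsφ
    have hwsim : 0 ≤ (ws - p).im := by
      simp only [hws, sub_im, ofReal_im, sub_zero]
      exact hgim zs hzsA'
    set θs : ℝ := arg (ws - p) with hθs
    have hθsmem : θs ∈ Icc (0 : ℝ) π := ⟨arg_nonneg_iff.2 hwsim, arg_le_pi _⟩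
    have hcirc : circleMap (p : ℂ) u θs = ws := by
      rw [circleMap, ← hwsu, hθs]
      have := Complex.norm_mul_exp_arg_mul_I (ws - p)
      rw [this]
      ring
    have hval : fT ws = zs := by
      simp only [hfT, hws, sub_add_cancel]
      exact hginv zs hzsA'
    have hsmall : ‖fT (circleMap (p : ℂ) u θs)‖ < R₁ := by
      rw [hcirc, hval, hR₁]
      linarith [hA'norm zs hzsA']
    -- the junction `p - u`
    have hjunct : circleMap (p : ℂ) u π = ((p - u : ℝ) : ℂ) := by
      rw [circleMap, Complex.exp_pi_mul_I]; push_cast; ring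
    have hjunct' : circleMap (0 : ℂ) (p - u) 0 = ((p - u : ℝ) : ℂ) := by
      rw [circleMap]; push_cast; simp
    by_cases hcase : R₃ ≤ ‖fT ((p - u : ℝ) : ℂ)‖
    · -- family 1 crosses `(R₁, R₂)`
      left
      obtain ⟨θ', hθ', h1⟩ := exists_mem_Ioo_mem_of_continuousOn Real.pi_pos (hfTc p u hu0) hθsmem
        (isOpen_lt continuous_norm continuous_const) hsmall
      obtain ⟨θ'', hθ'', h2⟩ := exists_mem_Ioo_mem_of_continuousOn Real.pi_pos (hfTc p u hu0)
        ⟨Real.pi_pos.le, le_rfl⟩ (isOpen_lt continuous_const continuous_norm)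
        (show R₂ < ‖fT (circleMap (p : ℂ) u π)‖ by
          rw [hjunct]
          exact lt_of_lt_of_le (by rw [hR₂]; linarith) hcase)
      exact ⟨θ', hθ', θ'', hθ'', h1, h2⟩
    · -- family 2 crosses `(R₃, R₄)`
      right
      rw [not_le] at hcase
      have hpu : 0 < p - u := by linarith
      obtain ⟨θ', hθ', h1⟩ := exists_mem_Ioo_mem_of_continuousOn Real.pi_pos
        (by simpa using hfTc 0 (p - u) hpu) ⟨le_rfl, Real.pi_pos.le⟩
        (isOpen_lt continuous_norm continuous_const)
        (show ‖fT (circleMap (0 : ℂ) (p - u) 0)‖ < R₃ by rwa [hjunct'])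
      -- the semicircle about `Wₜ` of radius `p - u` reaches `|z| ≥ r`
      obtain ⟨θ₀, hθ₀, hbig⟩ := exists_le_norm_bdryInv_circleMap hW hW0 hγ hs hrpos hex hpu
        (by rw [hc] at *; linarith)
      have hrel : ∀ θ, fT (circleMap (0 : ℂ) (p - u) θ) = bdryInv W t (circleMap (W t : ℂ) (p - u) θ) := by
        intro θ
        simp only [hfT, circleMap, zero_add, hc]
        ring_nf
      obtain ⟨θ'', hθ'', h2⟩ := exists_mem_Ioo_mem_of_continuousOn Real.pi_pos
        (by simpa using hfTc 0 (p - u) hpu) hθ₀ (isOpen_lt continuous_const continuous_norm)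
        (show R₄ < ‖fT (circleMap (0 : ℂ) (p - u) θ₀)‖ by
          rw [hrel, hR₄]
          linarith)
      exact ⟨θ', hθ', θ'', hθ'', h1, h2⟩
  -- the length–area inequality
  have hineq := Literature.Analysis.Complex.AnnulusCrossing.mul_log_le_of_forall_crossing_or hf hinj
    (by positivity : 0 < R₁) hR₁₂ hR₃pos hR₃₄ hLrpos le_rfl hL₂ hm'pos hm'p hcross
  -- `m' (Lr log 2 − 2π²) ≤ 4π² p` with `Lr log 2 − 2π² > 4π²/δ₂`
  set K : ℝ := Lr * Real.log 2 - 2 * π ^ 2 with hKdef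
  have hK : 4 * π ^ 2 / δ₂ < K := by
    have h1 : L₀ * Real.log 2 ≤ Lr * Real.log 2 := mul_le_mul_of_nonneg_right hLrL₀ hlog2.le
    have h2 : L₀ * Real.log 2 = 2 * π ^ 2 + 4 * π ^ 2 / δ₂ + Real.log 2 := by
      rw [hL₀]
      field_simp
    rw [hKdef]
    linarith
  have hKpos : 0 < K := lt_trans (by positivity) hK
  have hm'K : m' * K ≤ 4 * π ^ 2 * p := by
    have : m' * K = Lr * Real.log 2 * m' - 2 * π ^ 2 * m' := by rw [hKdef]; ring
    rw [this]
    linarith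
  have hδK : 4 * π ^ 2 < K * δ₂ := (div_lt_iff₀ hδ₂pos).1 hK
  have hm'lt : m' < δ₂ * p := by
    by_contra hle
    rw [not_lt] at hle
    have h1 : δ₂ * p * K ≤ m' * K := mul_le_mul_of_nonneg_right hle hKpos.le
    have h2 : 4 * π ^ 2 * p < K * δ₂ * p := mul_lt_mul_of_pos_right hδK hppos
    have h3 : K * δ₂ * p = δ₂ * p * K := by ring
    linarith
  have hδ₂4 : δ₂ ≤ 1 / 4 := min_le_right _ _
  have hm'lt' : m' < p / 4 := by
    have : δ₂ * p ≤ 1 / 4 * p := mul_le_mul_of_nonneg_right hδ₂4 hppos.le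
    linarith
  have hmm' : m' = m := by
    rw [hm']
    refine min_eq_left ?_
    by_contra hlt
    rw [not_le] at hlt
    have : m' = p / 2 := by rw [hm']; exact min_eq_right hlt.le
    linarith
  rw [← hmm']
  have hδ₂δ : δ₂ * p ≤ δ * p := mul_le_mul_of_nonneg_right (min_le_left _ _) hppos.le
  linarith

omit hW hW0 hγ hs in
/-- **[LSW] Lemma 6.2 holds for chains from the origin generated by a simple curve**
(`restrictionDeriv_exitTime_gt_simple`): by `exists_slidHull_subset_closedBall` the slid hull
at a large exit time lies in `D̄(p, δ p)` about a real `p > 0`, and such `*`-hulls have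
`Φ'(0) > 1 − ε` (`exists_delta_lt_restrictionDeriv`). [cite: LawlerSchrammWerner2003Restriction, Lemma 6.2] -/
theorem restrictionDeriv_exitTime_gt_simple_holds : restrictionDeriv_exitTime_gt_simple := by
  intro W hW hW0 γ hγ hs A hA hdisj ε hε
  rcases A.eq_empty_or_nonempty with rfl | hne
  · -- the empty hull: `A_t − W_t = ∅` and `e = 1`
    refine ⟨0, fun r _ t _ Ψ e hΨ he ↦ ?_⟩
    have key : ∀ B : Set ℂ, B = ∅ →
        ∀ (Ψ : ConformalEquiv (upperHalfPlaneSet \ B) upperHalfPlaneSet) (e : ℝ),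
          IsRestrictionMap B Ψ → HasRestrictionDeriv B Ψ e → e = 1 := by
      rintro B rfl Ψ e hΨ he
      exact HasRestrictionDeriv.eq_of_isRestrictionMap IsStarHull.existsUnique_isRestrictionMap_holds
        isStarHull_empty isRestrictionMap_empty hΨ hasRestrictionDeriv_empty he
    rw [key _ (slidHull_empty W t) Ψ e hΨ he]
    linarith
  · obtain ⟨δ, hδ, hcomp⟩ := exists_delta_lt_restrictionDeriv hε
    obtain ⟨r₀, hr₀⟩ := exists_slidHull_subset_closedBall hW hW0 hγ hs hA hne hdisj hδ
    refine ⟨r₀, fun r hr t hex Ψ e hΨ he ↦ ?_⟩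
    obtain ⟨p, m, hp, -, hmp, hsub⟩ := hr₀ r hr t hex
    -- the slid hull is a `*`-hull
    obtain ⟨Φ, hΦ, -⟩ := IsStarHull.existsUnique_isRestrictionMap_holds hA.1
    have hdisj' : Disjoint (γ '' Icc 0 t) A :=
      (hdisj t).mono_left (image_subset_closedHull_of_isSimpleTrace hγ hs t)
    have hstar : IsStarHull (slidHull W A t) := hγ.isStarHull_slidHull hW hW0 hs hA.1 hΦ hdisj'
    exact hcomp hp hstar (hsub.trans (closedBall_subset_closedBall hmp)) hΨ he

end Main

end Loewner




end Literature.Probability.RandomPlanarGeometry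

end
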